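import Summits.ResolutionOfSingularities.ResolutionOfSingularities.Theorems.FrobeniusClosingPatchingRelPerfectCoreRungTowerCharts
import HarnessLib

/-!
# Crux `PatchingRelPerfect` (stmt-ResolutionOfSingularities-16161), chain w52 — CORE RUNG r1τ,
# part 7: the EUCLIDEAN TOWER `(w)ᵅ + (tᵝ)` over the Rees charts (ring level, any regular ring)

[OURS · L1 W5.2 · rung r1τ] The regular-centre tower of part 1 (`…CoreRungTowerCharts.lean`)
principalises `(w) + (tᴺ)`; this file runs the full (subtractive) EUCLIDEAN ALGORITHM on the
exponent pair of `K = (w₁, …, w_c)ᵅ + (tᵝ)` for a quasi-regular sequence `(t, w)` with regular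
quotient in a regular ring `R`: blow up `𝔫 = (t, w)`; on the `t`-chart `K = tᵅ · ((w')ᵅ + tᵝ⁻ᵅ)`
if `α ≤ β` (same shape, exponents `(α, β − α)`), Cartier if `α > β`; on a `w_l`-chart `K` is
Cartier if `α ≤ β` and `K = w_lᵝ · ((t')ᵝ + w_lᵅ⁻ᵝ)` if `α > β` — the same shape for the SWAPPED
pair (block `(t')` = strict transform of the old exceptional divisor, element `w_l` = the new one),
exponents `(β, α − β)`.  All centres are intersections of two regular divisors meeting
transversally (codimension `c + 1` resp. `2`), so the chart family lemmas of part 1 keep the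
induction inside "quasi-regular with regular quotient in a regular ring".  The companion is a
product of ideals `(w)ⁱ + (tʲ)` indexed by a list of exponent pairs `L(α, β)` depending only on
`(α, β)` (the convergents of the slow continued fraction of `β/α`), produced EXISTENTIALLY (no new
definition).  PROVED:

* `CoreRungTower.euclid_exponents` — for all `α, β` there is a list `L` of exponent pairs such that
  for EVERY regular ring `R`, every quasi-regular `(t, w₁, …, w_c)` with `R/(t, w)` regular, every
  blowing up of `Spec R` along `((w)ᵅ + (tᵝ)) · ∏_{(i,j) ∈ L} ((w)ⁱ + (tʲ))` is regular;
* the chart images of the factors `(w)ⁱ + (tʲ)` in both exponent regimes on both kinds of charts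
  and the list/product bookkeeping (`CoreRungTower.map_listProd`, `listProd_twist`, …).

The local rungs (`(z)ᵃ + 𝔪ᵇ` for ALL `a, b`; cone-form thickenings `(qᵃ) + 𝔪ᵐ` for ALL
`m ≥ a·ord q`) are assembled in `…CoreRungTowerEuclidRungs.lean`.  Arbitrary regular rings; FORMAT
evidence for the core only (CHAIN §1 (A)); nothing here is a statement of the manuscript under
review.

## References

* Q. Liu, *Algebraic Geometry and Arithmetic Curves*, OUP 2002, Thm. 8.1.19 (a). [Liu2002]
* The Stacks Project, Tags 080A, 080B, 0804, 0BIQ. [StacksProject]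
* O. Zariski, P. Samuel, *Commutative Algebra II*, Appendix 5 (complete ideals in dimension 2).
  [ZariskiSamuel1960]
-/

-- `Summit.<Summit>.<Sub>.Theorems` with `Sub = Summit` (single-conjunct summit, D-0017)
set_option linter.dupNamespace false

noncomputable section

open CategoryTheory CategoryTheory.Limits AlgebraicGeometry Literature.AlgebraicGeometry.Resolution

namespace Summit.ResolutionOfSingularities.ResolutionOfSingularities.Theorems

universe u

namespace CoreRungTower

/-! ## List products of ideals -/

/-- `Ideal.map` commutes with products over lists. [folklore] -/
theorem map_listProd {R S : Type*} [CommSemiring R] [CommSemiring S] (f : R →+* S) {ι : Type*}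
    (L : List ι) (G : ι → Ideal R) :
    ((L.map G).prod).map f = (L.map fun p => (G p).map f).prod := by
  induction L with
  | nil => simp only [List.map_nil, List.prod_nil, Ideal.one_eq_top, Ideal.map_top]
  | cons a L ih => rw [List.map_cons, List.map_cons, List.prod_cons, List.prod_cons, Ideal.map_mul, ih]

/-- Collecting Cartier twists out of a list product:
`∏ ((gᵃ⁽ᵖ⁾) · H p) = (g^{Σ a(p)}) · ∏ H p`. [folklore] -/
theorem listProd_twist {R : Type*} [CommSemiring R] (g : R) {ι : Type*} (L : List ι)
    (a : ι → ℕ) (H : ι → Ideal R) :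
    (L.map fun p => Ideal.span {g ^ a p} * H p).prod =
      Ideal.span {g ^ (L.map a).sum} * (L.map H).prod := by
  induction L with
  | nil =>
    simp only [List.map_nil, List.prod_nil, List.sum_nil, pow_zero, Ideal.span_singleton_one,
      Ideal.one_eq_top, Ideal.top_mul]
  | cons p L ih =>
    rw [List.map_cons, List.map_cons, List.map_cons, List.prod_cons, List.prod_cons, List.sum_cons,
      ih, pow_add, ← Ideal.span_singleton_mul_span_singleton]
    ring

/-- A list product of principal powers is the principal power of the sum. [folklore] -/
theorem listProd_span_pow {R : Type*} [CommSemiring R] (g : R) {ι : Type*} (L : List ι)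
    (a : ι → ℕ) :
    (L.map fun p => Ideal.span {g ^ a p}).prod = Ideal.span {g ^ (L.map a).sum} := by
  induction L with
  | nil =>
    simp only [List.map_nil, List.prod_nil, List.sum_nil, pow_zero, Ideal.span_singleton_one,
      Ideal.one_eq_top]
  | cons p L ih =>
    rw [List.map_cons, List.map_cons, List.prod_cons, List.sum_cons, ih, pow_add,
      Ideal.span_singleton_mul_span_singleton]

/-! ## Chart images of the factors `(w)ⁱ + (tʲ)` -/

section ChartImages

variable {R : Type u} [CommRing R] {c : ℕ} (t : R) (w : Fin c → R)

local notation3 "xx" => (Fin.cons t w : Fin (c + 1) → R)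
local notation3 "P" => Ideal.span (Set.range w)

/-- On the `t`-chart: `(w) · B₀ = (t) · (w/t)`. [cite: StacksProject, Tag 0804] -/
theorem map_chartBase_zero_span :
    (P).map (chartBase xx 0) = Ideal.span {chartBase xx 0 t} *
      Ideal.span (Set.range fun k => chartGen xx 0 (Fin.succ k)) :=
  CoreRungTower.map_chartBase_span_comp xx Fin.succ 0

/-- On a `w_l`-chart: `(w) · B_l = (w_l)`. [cite: StacksProject, Tag 0804] -/
theorem map_chartBase_succ_span (l : Fin c) :
    (P).map (chartBase xx (Fin.succ l)) = Ideal.span {chartBase xx (Fin.succ l) (w l)} := by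
  have h := CoreRungTower.map_chartBase_span_comp xx Fin.succ (Fin.succ l)
  rw [CoreRungTower.span_chartGen_eq_top_of_eq xx Fin.succ (Fin.succ l) l rfl, Ideal.mul_top] at h
  exact h

/-- **`t`-chart, small `w`-exponent**: `((w)ⁱ + (tⁱ⁺ᵏ)) · B₀ = (tⁱ) · ((w')ⁱ + (tᵏ))`.
[cite: StacksProject, Tag 0804] -/
theorem map_chartBase_zero_factor_le (i k : ℕ) :
    (P ^ i ⊔ Ideal.span {t ^ (i + k)}).map (chartBase xx 0) =
      Ideal.span {chartBase xx 0 t ^ i} *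
        (Ideal.span (Set.range fun k => chartGen xx 0 (Fin.succ k)) ^ i ⊔
          Ideal.span {chartBase xx 0 t ^ k}) := by
  rw [Ideal.map_sup, Ideal.map_pow, map_chartBase_zero_span, mul_pow, Ideal.span_singleton_pow,
    Ideal.map_span, Set.image_singleton, map_pow, pow_add, ← Ideal.span_singleton_mul_span_singleton,
    ← Ideal.mul_sup]

/-- **`t`-chart, large `w`-exponent**: `((w)ⁱ⁺ᵏ + (tⁱ)) · B₀ = (tⁱ)` is Cartier.
[cite: StacksProject, Tag 0804] -/
theorem map_chartBase_zero_factor_ge (i k : ℕ) :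
    (P ^ (i + k) ⊔ Ideal.span {t ^ i}).map (chartBase xx 0) = Ideal.span {chartBase xx 0 t ^ i} := by
  rw [Ideal.map_sup, Ideal.map_pow, map_chartBase_zero_span, mul_pow, Ideal.span_singleton_pow,
    Ideal.map_span, Set.image_singleton, map_pow]
  refine le_antisymm (sup_le ?_ le_rfl) le_sup_right
  rw [pow_add, ← Ideal.span_singleton_mul_span_singleton, mul_assoc]
  exact Ideal.mul_le_right

/-- **`w_l`-chart, small `w`-exponent**: `((w)ⁱ + (tⁱ⁺ᵏ)) · B_l = (w_lⁱ)` is Cartier.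
[cite: StacksProject, Tag 0804] -/
theorem map_chartBase_succ_factor_le (l : Fin c) (i k : ℕ) :
    (P ^ i ⊔ Ideal.span {t ^ (i + k)}).map (chartBase xx (Fin.succ l)) =
      Ideal.span {chartBase xx (Fin.succ l) (w l) ^ i} := by
  have ht : chartBase xx (Fin.succ l) t =
      chartBase xx (Fin.succ l) (w l) * chartGen xx (Fin.succ l) 0 :=
    reesChartBase_apply_eq_mul_chartGen xx (Fin.succ l) 0
  have htn : chartBase xx (Fin.succ l) t ^ (i + k) = chartBase xx (Fin.succ l) (w l) ^ i *
      (chartBase xx (Fin.succ l) (w l) ^ k * chartGen xx (Fin.succ l) 0 ^ (i + k)) := by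
    rw [ht]; ring
  rw [Ideal.map_sup, Ideal.map_pow, map_chartBase_succ_span, Ideal.span_singleton_pow, Ideal.map_span,
    Set.image_singleton, map_pow, htn, ← Ideal.span_singleton_mul_span_singleton]
  exact le_antisymm (sup_le le_rfl Ideal.mul_le_right) le_sup_left

/-- **`w_l`-chart, large `w`-exponent**: `((w)ⁱ⁺ᵏ + (tⁱ)) · B_l = (w_lⁱ) · ((t')ⁱ + (w_lᵏ))`, the
factor of the SWAPPED pair (block `t' = t/w_l`, element `w_l`). [cite: StacksProject, Tag 0804] -/
theorem map_chartBase_succ_factor_ge (l : Fin c) (i k : ℕ) :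
    (P ^ (i + k) ⊔ Ideal.span {t ^ i}).map (chartBase xx (Fin.succ l)) =
      Ideal.span {chartBase xx (Fin.succ l) (w l) ^ i} *
        (Ideal.span (Set.range fun _ : Fin 1 => chartGen xx (Fin.succ l) 0) ^ i ⊔
          Ideal.span {chartBase xx (Fin.succ l) (w l) ^ k}) := by
  have ht : chartBase xx (Fin.succ l) t =
      chartBase xx (Fin.succ l) (w l) * chartGen xx (Fin.succ l) 0 :=
    reesChartBase_apply_eq_mul_chartGen xx (Fin.succ l) 0
  have hti : chartBase xx (Fin.succ l) t ^ i =
      chartBase xx (Fin.succ l) (w l) ^ i * chartGen xx (Fin.succ l) 0 ^ i := by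
    rw [ht]; ring
  rw [Ideal.map_sup, Ideal.map_pow, map_chartBase_succ_span, Ideal.span_singleton_pow, Ideal.map_span,
    Set.image_singleton, map_pow, hti, pow_add, Set.range_const, Ideal.span_singleton_pow,
    ← Ideal.span_singleton_mul_span_singleton, ← Ideal.span_singleton_mul_span_singleton,
    ← Ideal.mul_sup, sup_comm]

/-- **`t`-chart, list of small-`w`-exponent factors**: the product becomes a Cartier twist of the
list for the chart family. [cite: StacksProject, Tag 0804] -/
theorem map_chartBase_zero_prod_le (L : List (ℕ × ℕ)) :
    ((L.map fun p : ℕ × ℕ => P ^ p.1 ⊔ Ideal.span {t ^ (p.1 + p.2)}).prod).map (chartBase xx 0) =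
      Ideal.span {chartBase xx 0 t ^ (L.map Prod.fst).sum} *
        (L.map fun p : ℕ × ℕ => Ideal.span (Set.range fun k => chartGen xx 0 (Fin.succ k)) ^ p.1 ⊔
          Ideal.span {chartBase xx 0 t ^ p.2}).prod := by
  rw [map_listProd]
  simp_rw [map_chartBase_zero_factor_le t w]
  exact listProd_twist _ L Prod.fst _

/-- **`t`-chart, list of large-`w`-exponent factors**: the product becomes Cartier.
[cite: StacksProject, Tag 0804] -/
theorem map_chartBase_zero_prod_ge (L : List (ℕ × ℕ)) :
    ((L.map fun p : ℕ × ℕ => P ^ (p.1 + p.2) ⊔ Ideal.span {t ^ p.1}).prod).map (chartBase xx 0) =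
      Ideal.span {chartBase xx 0 t ^ (L.map Prod.fst).sum} := by
  rw [map_listProd]
  simp_rw [map_chartBase_zero_factor_ge t w]
  exact listProd_span_pow _ L Prod.fst

/-- **`w_l`-chart, list of small-`w`-exponent factors**: the product becomes Cartier.
[cite: StacksProject, Tag 0804] -/
theorem map_chartBase_succ_prod_le (l : Fin c) (L : List (ℕ × ℕ)) :
    ((L.map fun p : ℕ × ℕ => P ^ p.1 ⊔ Ideal.span {t ^ (p.1 + p.2)}).prod).map
        (chartBase xx (Fin.succ l)) =
      Ideal.span {chartBase xx (Fin.succ l) (w l) ^ (L.map Prod.fst).sum} := by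
  rw [map_listProd]
  simp_rw [map_chartBase_succ_factor_le t w l]
  exact listProd_span_pow _ L Prod.fst

/-- **`w_l`-chart, list of large-`w`-exponent factors**: the product becomes a Cartier twist of
the list for the swapped pair. [cite: StacksProject, Tag 0804] -/
theorem map_chartBase_succ_prod_ge (l : Fin c) (L : List (ℕ × ℕ)) :
    ((L.map fun p : ℕ × ℕ => P ^ (p.1 + p.2) ⊔ Ideal.span {t ^ p.1}).prod).map
        (chartBase xx (Fin.succ l)) =
      Ideal.span {chartBase xx (Fin.succ l) (w l) ^ (L.map Prod.fst).sum} *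
        (L.map fun p : ℕ × ℕ =>
          Ideal.span (Set.range fun _ : Fin 1 => chartGen xx (Fin.succ l) 0) ^ p.1 ⊔
            Ideal.span {chartBase xx (Fin.succ l) (w l) ^ p.2}).prod := by
  rw [map_listProd]
  simp_rw [map_chartBase_succ_factor_ge t w l]
  exact listProd_twist _ L Prod.fst _

end ChartImages

/-! ## The Euclidean tower -/

set_option maxHeartbeats 400000 in
/-- **THE EUCLIDEAN TOWER (ring level), with an explicit bound for the induction.**  For all
`α + β ≤ s` there is a list `L` of exponent pairs such that for every regular ring `R`, every
quasi-regular `(t, w₁, …, w_c)` with `R/(t, w)` regular, every blowing up of `Spec R` along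
`((w)ᵅ + (tᵝ)) · ∏_{(i,j)∈L} ((w)ⁱ + (tʲ))` is regular.  `L(α, β) = (1,1) :: L(α, β−α)⁽ⁱ,ⁱ⁺ʲ⁾`
if `1 ≤ α ≤ β`, `(1,1) :: L(β, α−β)⁽ⁱ⁺ʲ,ⁱ⁾` if `1 ≤ β < α`, `[]` if `α β = 0`.
[cite: Liu2002, Thm. 8.1.19 (a)] [cite: StacksProject, Tag 080A] [cite: ZariskiSamuel1960, App. 5] -/
theorem euclid_exponents_aux (s : ℕ) : ∀ α β : ℕ, α + β ≤ s → ∃ L : List (ℕ × ℕ),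
    ∀ {R : Type u} [CommRing R] [IsRegularRing R] {c : ℕ} (t : R) (w : Fin c → R),
      IsQuasiRegular (Fin.cons t w : Fin (c + 1) → R) →
      IsRegularRing (R ⧸ Ideal.span (Set.range (Fin.cons t w : Fin (c + 1) → R))) →
      ∀ {Y : Scheme.{u}} {f : Y ⟶ Spec (.of R)},
        IsBlowup f (affineBlowup.idealSheaf
          ((Ideal.span (Set.range w) ^ α ⊔ Ideal.span {t ^ β}) *
            (L.map fun p : ℕ × ℕ => Ideal.span (Set.range w) ^ p.1 ⊔ Ideal.span {t ^ p.2}).prod)) →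
        Scheme.IsRegular Y := by
  induction s with
  | zero =>
    intro α β hs
    refine ⟨[], fun t w _ _ Y f hf => ?_⟩
    obtain ⟨rfl, rfl⟩ : α = 0 ∧ β = 0 := ⟨by omega, by omega⟩
    rw [pow_zero, pow_zero, Ideal.one_eq_top, top_sup_eq, List.map_nil, List.prod_nil, Ideal.one_eq_top,
      Ideal.top_mul, affineBlowup.idealSheaf_top] at hf
    haveI : IsIso f := hf.isIso isEffectiveCartier_top
    haveI : IsRegularRing (CommRingCat.of _) := ‹IsRegularRing _›
    exact SectionAscent.TraceIdeal.isRegular_of_iso (asIso f) (Scheme.isRegular_Spec _)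
  | succ s ih =>
    intro α β hs
    -- degenerate exponents: the ideal is the unit ideal
    by_cases h0 : α = 0 ∨ β = 0
    · refine ⟨[], fun t w _ _ Y f hf => ?_⟩
      have htop : Ideal.span (Set.range w) ^ α ⊔ Ideal.span {t ^ β} = ⊤ := by
        rcases h0 with rfl | rfl
        · rw [pow_zero, Ideal.one_eq_top, top_sup_eq]
        · rw [pow_zero, Ideal.span_singleton_one, sup_top_eq]
      rw [htop, List.map_nil, List.prod_nil, Ideal.one_eq_top, Ideal.top_mul,
        affineBlowup.idealSheaf_top] at hf
      haveI : IsIso f := hf.isIso isEffectiveCartier_top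
      haveI : IsRegularRing (CommRingCat.of _) := ‹IsRegularRing _›
      exact SectionAscent.TraceIdeal.isRegular_of_iso (asIso f) (Scheme.isRegular_Spec _)
    rw [not_or] at h0
    obtain ⟨hα, hβ⟩ := h0
    by_cases hle : α ≤ β
    · -- Case A: continue on the `t`-chart with exponents `(α, β - α)`
      obtain ⟨k, rfl⟩ : ∃ k, β = α + k := ⟨β - α, by omega⟩
      obtain ⟨L', hL'⟩ := ih α k (by omega)
      refine ⟨(1, 1) :: L'.map (fun p => (p.1, p.1 + p.2)), ?_⟩
      intro R _ _ c t w hx hR Y f hf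
      haveI := hR
      have hPM : Ideal.span (Set.range w) ⊔ Ideal.span {t} =
          Ideal.span (Set.range (Fin.cons t w : Fin (c + 1) → R)) := by
        rw [Fin.range_cons, Ideal.span_insert, sup_comm]
      -- peel off the centre `𝔫 = (t, w)` (the head `(1,1)`)
      rw [List.map_cons, List.prod_cons, pow_one, pow_one, hPM, mul_left_comm, List.map_map] at hf
      rw [mul_comm] at hf
      refine isRegular_of_isBlowup_mul_of_charts (Fin.cons t w : Fin (c + 1) → R) _
        (fun i => ?_) hf
      refine Fin.cases ?_ (fun l => ?_) i
      · -- the `t`-chart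
        intro Y' ρ hρ
        haveI hB : IsRegularRing (chartRing (Fin.cons t w : Fin (c + 1) → R) 0) :=
          isRegularRing_blowupChart _ 0 hx
        have hti : chartBase (Fin.cons t w : Fin (c + 1) → R) 0 t ∈
            nonZeroDivisors (chartRing (Fin.cons t w : Fin (c + 1) → R) 0) :=
          reesChartBase_mem_nonZeroDivisors ((Fin.cons t w : Fin (c + 1) → R) 0)
            (Ideal.mem_span_range_self (f := (Fin.cons t w : Fin (c + 1) → R)) (x := 0))
        simp only [Function.comp_def] at hρ
        rw [Ideal.map_mul, map_chartBase_zero_factor_le, map_chartBase_zero_prod_le, mul_mul_mul_comm,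
          Ideal.span_singleton_mul_span_singleton] at hρ
        refine CoreRungTower.isRegular_of_isBlowup_span_singleton_mul
          (mul_mem (pow_mem hti _) (pow_mem hti _)) _ (fun Y'' ρ' hρ' => ?_) hρ
        -- the chart family `(t, w')` is again quasi-regular with regular quotient
        let jJ : Fin c → {j : Fin (c + 1) // j ≠ 0} := fun k => ⟨Fin.succ k, Fin.succ_ne_zero k⟩
        have hjJ : Function.Injective jJ := fun k k' h =>
          Fin.succ_injective c (congrArg Subtype.val h)
        have hx' := CoreRungTower.isQuasiRegular_chartFamily (Fin.cons t w : Fin (c + 1) → R) 0 jJ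
          hx hjJ
        have hR' := CoreRungTower.isRegularRing_quot_chartFamily (Fin.cons t w : Fin (c + 1) → R) 0
          jJ hx
        exact hL' (chartBase (Fin.cons t w : Fin (c + 1) → R) 0 t)
          (fun k => chartGen (Fin.cons t w : Fin (c + 1) → R) 0 (Fin.succ k)) hx' hR' hρ'
      · -- a `w_l`-chart: everything is Cartier
        intro Y' ρ hρ
        haveI hB : IsRegularRing (chartRing (Fin.cons t w : Fin (c + 1) → R) (Fin.succ l)) :=
          isRegularRing_blowupChart _ (Fin.succ l) hx
        have hwi : chartBase (Fin.cons t w : Fin (c + 1) → R) (Fin.succ l) (w l) ∈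
            nonZeroDivisors (chartRing (Fin.cons t w : Fin (c + 1) → R) (Fin.succ l)) :=
          reesChartBase_mem_nonZeroDivisors ((Fin.cons t w : Fin (c + 1) → R) (Fin.succ l))
            (Ideal.mem_span_range_self (f := (Fin.cons t w : Fin (c + 1) → R)) (x := Fin.succ l))
        simp only [Function.comp_def] at hρ
        rw [Ideal.map_mul, map_chartBase_succ_factor_le, map_chartBase_succ_prod_le,
          Ideal.span_singleton_mul_span_singleton] at hρ
        haveI : IsRegularRing (CommRingCat.of (chartRing (Fin.cons t w : Fin (c + 1) → R)
          (Fin.succ l))) := hB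
        exact isRegular_of_isBlowup_idealSheaf_span_singleton_of_isRegularRing
          (mul_mem (pow_mem hwi _) (pow_mem hwi _)) hρ
    · -- Case B: continue on every `w_l`-chart with the swapped pair, exponents `(β, α - β)`
      obtain ⟨k, rfl⟩ : ∃ k, α = β + k := ⟨α - β, by omega⟩
      obtain ⟨L', hL'⟩ := ih β k (by omega)
      refine ⟨(1, 1) :: L'.map (fun p => (p.1 + p.2, p.1)), ?_⟩
      intro R _ _ c t w hx hR Y f hf
      haveI := hR
      have hPM : Ideal.span (Set.range w) ⊔ Ideal.span {t} =
          Ideal.span (Set.range (Fin.cons t w : Fin (c + 1) → R)) := by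
        rw [Fin.range_cons, Ideal.span_insert, sup_comm]
      rw [List.map_cons, List.prod_cons, pow_one, pow_one, hPM, mul_left_comm, List.map_map] at hf
      rw [mul_comm] at hf
      refine isRegular_of_isBlowup_mul_of_charts (Fin.cons t w : Fin (c + 1) → R) _
        (fun i => ?_) hf
      refine Fin.cases ?_ (fun l => ?_) i
      · -- the `t`-chart: everything is Cartier
        intro Y' ρ hρ
        haveI hB : IsRegularRing (chartRing (Fin.cons t w : Fin (c + 1) → R) 0) :=
          isRegularRing_blowupChart _ 0 hx
        have hti : chartBase (Fin.cons t w : Fin (c + 1) → R) 0 t ∈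
            nonZeroDivisors (chartRing (Fin.cons t w : Fin (c + 1) → R) 0) :=
          reesChartBase_mem_nonZeroDivisors ((Fin.cons t w : Fin (c + 1) → R) 0)
            (Ideal.mem_span_range_self (f := (Fin.cons t w : Fin (c + 1) → R)) (x := 0))
        simp only [Function.comp_def] at hρ
        rw [Ideal.map_mul, map_chartBase_zero_factor_ge, map_chartBase_zero_prod_ge,
          Ideal.span_singleton_mul_span_singleton] at hρ
        haveI : IsRegularRing (CommRingCat.of (chartRing (Fin.cons t w : Fin (c + 1) → R) 0)) := hB
        exact isRegular_of_isBlowup_idealSheaf_span_singleton_of_isRegularRing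
          (mul_mem (pow_mem hti _) (pow_mem hti _)) hρ
      · -- a `w_l`-chart: the swapped pair `(w_l ; t')`
        intro Y' ρ hρ
        haveI hB : IsRegularRing (chartRing (Fin.cons t w : Fin (c + 1) → R) (Fin.succ l)) :=
          isRegularRing_blowupChart _ (Fin.succ l) hx
        have hwi : chartBase (Fin.cons t w : Fin (c + 1) → R) (Fin.succ l) (w l) ∈
            nonZeroDivisors (chartRing (Fin.cons t w : Fin (c + 1) → R) (Fin.succ l)) :=
          reesChartBase_mem_nonZeroDivisors ((Fin.cons t w : Fin (c + 1) → R) (Fin.succ l))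
            (Ideal.mem_span_range_self (f := (Fin.cons t w : Fin (c + 1) → R)) (x := Fin.succ l))
        simp only [Function.comp_def] at hρ
        rw [Ideal.map_mul, map_chartBase_succ_factor_ge, map_chartBase_succ_prod_ge, mul_mul_mul_comm,
          Ideal.span_singleton_mul_span_singleton] at hρ
        refine CoreRungTower.isRegular_of_isBlowup_span_singleton_mul
          (mul_mem (pow_mem hwi _) (pow_mem hwi _)) _ (fun Y'' ρ' hρ' => ?_) hρ
        let jJ : Fin 1 → {j : Fin (c + 1) // j ≠ Fin.succ l} :=
          fun _ => ⟨0, (Fin.succ_ne_zero l).symm⟩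
        have hjJ : Function.Injective jJ := fun a b _ => Subsingleton.elim a b
        have hx' := CoreRungTower.isQuasiRegular_chartFamily (Fin.cons t w : Fin (c + 1) → R)
          (Fin.succ l) jJ hx hjJ
        have hR' := CoreRungTower.isRegularRing_quot_chartFamily (Fin.cons t w : Fin (c + 1) → R)
          (Fin.succ l) jJ hx
        exact hL' (chartBase (Fin.cons t w : Fin (c + 1) → R) (Fin.succ l) (w l))
          (fun _ : Fin 1 => chartGen (Fin.cons t w : Fin (c + 1) → R) (Fin.succ l) 0) hx' hR' hρ'

/-- **THE EUCLIDEAN TOWER (ring level).** For all exponents `α, β` there is a list `L` of exponent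
pairs (depending only on `(α, β)`) such that for every regular ring `R` and every quasi-regular
`(t, w₁, …, w_c)` with `R/(t, w)` a regular ring, every blowing up of `Spec R` along
`((w)ᵅ + (tᵝ)) · ∏_{(i,j)∈L} ((w)ⁱ + (tʲ))` is regular — the Euclidean algorithm on `(α, β)` run as
a tower of blowing ups of regular centres `strict transform of V(w) ∩ newest exceptional divisor`
resp. `two exceptional components`. [cite: Liu2002, Thm. 8.1.19 (a)] [cite: StacksProject, Tag 080A]
[cite: ZariskiSamuel1960, App. 5] -/
theorem euclid_exponents (α β : ℕ) : ∃ L : List (ℕ × ℕ),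
    ∀ {R : Type u} [CommRing R] [IsRegularRing R] {c : ℕ} (t : R) (w : Fin c → R),
      IsQuasiRegular (Fin.cons t w : Fin (c + 1) → R) →
      IsRegularRing (R ⧸ Ideal.span (Set.range (Fin.cons t w : Fin (c + 1) → R))) →
      ∀ {Y : Scheme.{u}} {f : Y ⟶ Spec (.of R)},
        IsBlowup f (affineBlowup.idealSheaf
          ((Ideal.span (Set.range w) ^ α ⊔ Ideal.span {t ^ β}) *
            (L.map fun p : ℕ × ℕ => Ideal.span (Set.range w) ^ p.1 ⊔ Ideal.span {t ^ p.2}).prod)) →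
        Scheme.IsRegular Y :=
  euclid_exponents_aux (α + β) α β le_rfl

end CoreRungTower

end Summit.ResolutionOfSingularities.ResolutionOfSingularities.Theorems

end
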